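/- LEAD seat `ym-line-cbag-p1` (prover-ym-line-cbag-p1-g24-0), route `EguchiKawaiDirectionLadder` (ideator ym-idea-2, LINE 8),
crux K_A `TripleSmallBallMargin` (stmt-QuantumFields-27724), architecture note ARCH-27724-lead-g24 §4 (S2), LEMMAS FILE for the consumer-side circle → line reduction of width seat w3's
sorted-line/nested engine `HaarColumns.haar_measure_entrywise_le` (the main theorem `entrywiseRigidity_holds` is in the sibling file
`…EntrywiseRigidityCircle.lean`): relabel the
eigenvalues in angular order starting from a cut placed after a SPARSE arc (pigeonhole), replace the chordal weights by their running
minimum along each row (nested by construction; by unimodality of `2 − 2cos` it only caps the weights of the `≤ 2N/m` rows inside the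
sparse arc, at a cost `(2/t)^{2N²/m} ≤ exp(N²(log 4 − η log t))`), and compare factor by factor with `pairFactor`.  With S3/S4/S5 landed
this makes the pair small-ball bound and the free triple bound (a′) THEOREMS.  ROUTE-INDEPENDENT (no Theses import).  Nothing here bears
on the Yang–Mills mass gap (barrier-ledger line onto `EguchiKawaiBreakdown`). -/
import Summits.QuantumFields.YangMills.Theorems.EguchiKawaiDirectionLadderRigidityDefs
import Summits.QuantumFields.YangMills.Theorems.EguchiKawaiDirectionLadderSingleLinkBlocksCells
import Summits.QuantumFields.YangMills.Theorems.EguchiKawaiDirectionLadderSingleLinkReductionCore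
import Summits.QuantumFields.YangMills.Theorems.EguchiKawaiDirectionLadderWeylSupBound
import Mathlib.Data.Fin.Tuple.Sort
import Mathlib.Combinatorics.Pigeonhole
import HarnessLib

/-!
# Route `EguchiKawaiDirectionLadder`, crux `TripleSmallBallMargin`: circle → line lemmas for entrywise rigidity (S2, lemmas)

Elementary ingredients of `entrywiseRigidity_holds` (sibling file):
* A. RELABELLING: `permUnitary_conj_apply` / `permUnitary_conj_diagonal` (conjugating a diagonal unitary by a permutation matrix relabels
  its entries) and `prod_Ioi_perm` (the unordered-pair product of a symmetric non-negative function is relabelling invariant).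
* B. THE CUT: `exists_sparse_cell` (pigeonhole: one of `m` grid arcs holds `≤ N/m + 1` of the eigenvalues), `cutAngle` (angle measured from the
  cut, in `[0,2π)`, same pairwise cosines), `cellOf_eq_of_cutAngle_gt` (the rows within `α` below the cut lie in the sparse cell).
* C. ONE FACTOR: `cos_le_max_of_gaps` (unimodality of `cos` on `[0, 2π]`, from w2's `cos_le_cos_of_mem_Icc`), `inv_one_add_le_pairFactor`
  (good rows: `(1 + a/(2t))⁻¹ ≤ pairFactor (κt) x` once `a ≥ min x c`, `κ = max 2 (8/c)`), `inv_one_add_le_pairFactor_mul` (bad rows lose `2/t`),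
  `prod_Ioi_le_prod_pow`, `card_filter_comp_perm`, `bad_rows_bookkeeping` (`(2/t)^{N(N/m+1)} ≤ exp(N²(log 4 − η log t))`).
All [folklore].
-/

set_option autoImplicit false

noncomputable section

open MeasureTheory Real
open scoped ENNReal
open Literature.Barriers.QuantumFields

namespace Summit.QuantumFields.YangMills.Theorems.EguchiKawaiDirectionLadder

open Literature.MathematicalPhysics.QuantumFieldTheory (haarProbability)

variable {N : ℕ}

/-! ### A. Relabelling: permutation conjugation of the first link, invariance of the pair product -/

/-- Entries of a permutation-conjugated unitary: `(P_σ U P_σ⁻¹)_{ij} = U_{σ i, σ j}`. -/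
theorem permUnitary_conj_apply (σ : Equiv.Perm (Fin N)) (U : UN N) (i j : Fin N) :
    ((permUnitary σ * U * (permUnitary σ)⁻¹ : UN N) : Matrix (Fin N) (Fin N) ℂ) i j =
      (U : Matrix (Fin N) (Fin N) ℂ) (σ i) (σ j) := by
  have hinv : ((permUnitary σ)⁻¹ : UN N) = permUnitary σ⁻¹ := by
    apply Subtype.ext
    change star ((σ.permMatrix ℂ : Matrix (Fin N) (Fin N) ℂ)) = (σ⁻¹).permMatrix ℂ
    rw [Matrix.star_eq_conjTranspose, Matrix.conjTranspose_permMatrix]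
  rw [hinv, Matrix.UnitaryGroup.mul_val, Matrix.UnitaryGroup.mul_val]
  change (σ.permMatrix ℂ * (U : Matrix (Fin N) (Fin N) ℂ) * (σ⁻¹).permMatrix ℂ) i j = _
  rw [Equiv.Perm.permMatrix, Equiv.Perm.permMatrix, PEquiv.toMatrix_toPEquiv_mul, PEquiv.mul_toMatrix_toPEquiv]
  simp [Matrix.submatrix_apply, Equiv.Perm.inv_def]

/-- The permutation conjugate of a diagonal unitary is the diagonal unitary with relabelled entries. -/
theorem permUnitary_conj_diagonal (σ : Equiv.Perm (Fin N)) {D : UN N} {d : Fin N → ℂ}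
    (hd : (D : Matrix (Fin N) (Fin N) ℂ) = Matrix.diagonal d) :
    ((permUnitary σ * D * (permUnitary σ)⁻¹ : UN N) : Matrix (Fin N) (Fin N) ℂ) = Matrix.diagonal (d ∘ σ) := by
  ext i j
  rw [permUnitary_conj_apply, hd, Matrix.diagonal_apply, Matrix.diagonal_apply]
  simp only [Function.comp_apply, EmbeddingLike.apply_eq_iff_eq]

/-- Relabelling invariance of a product over ORDERED distinct pairs. -/
theorem prod_erase_perm (σ : Equiv.Perm (Fin N)) (g : Fin N → Fin N → ℝ) :
    ∏ i, ∏ j ∈ Finset.univ.erase i, g (σ i) (σ j) = ∏ i, ∏ j ∈ Finset.univ.erase i, g i j := by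
  have hinner : ∀ i : Fin N, ∏ j ∈ Finset.univ.erase i, g (σ i) (σ j) = ∏ j ∈ Finset.univ.erase (σ i), g (σ i) j := by
    intro i
    have h := Finset.prod_map (Finset.univ.erase i) σ.toEmbedding (fun j => g (σ i) j)
    rw [Finset.map_erase, Finset.map_univ_equiv] at h
    exact h.symm
  simp_rw [hinner]
  exact Equiv.prod_comp σ (fun i => ∏ j ∈ Finset.univ.erase i, g i j)

/-- **Relabelling invariance of the unordered-pair product** of a symmetric non-negative function. -/
theorem prod_Ioi_perm (σ : Equiv.Perm (Fin N)) (g : Fin N → Fin N → ℝ) (hsymm : ∀ i j, g i j = g j i)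
    (hnn : ∀ i j, 0 ≤ g i j) :
    ∏ j, ∏ k ∈ Finset.Ioi j, g (σ j) (σ k) = ∏ j, ∏ k ∈ Finset.Ioi j, g j k := by
  have hsq : ∀ h : Fin N → Fin N → ℝ, (∀ i j, h i j = h j i) →
      (∏ j, ∏ k ∈ Finset.Ioi j, h j k) ^ 2 = ∏ i, ∏ j ∈ Finset.univ.erase i, h i j := by
    intro h hh
    rw [prod_erase_eq_prod_Ioi, sq, ← Finset.prod_mul_distrib]
    refine Finset.prod_congr rfl fun j _ => ?_
    rw [← Finset.prod_mul_distrib]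
    exact Finset.prod_congr rfl fun k _ => by rw [hh k j]
  have h1 := hsq (fun i j => g (σ i) (σ j)) (fun i j => hsymm _ _)
  have h2 := hsq g hsymm
  rw [prod_erase_perm σ g] at h1
  have hnn1 : 0 ≤ ∏ j, ∏ k ∈ Finset.Ioi j, g (σ j) (σ k) :=
    Finset.prod_nonneg fun _ _ => Finset.prod_nonneg fun _ _ => hnn _ _
  have hnn2 : 0 ≤ ∏ j, ∏ k ∈ Finset.Ioi j, g j k :=
    Finset.prod_nonneg fun _ _ => Finset.prod_nonneg fun _ _ => hnn _ _
  exact (pow_left_inj₀ hnn1 hnn2 two_ne_zero).1 (h1.trans h2.symm)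

/-! ### B. The sparse cell and the cut -/

/-- **Pigeonhole**: among `m ≥ 1` grid arcs one contains at most `N/m + 1` of the `N` points. -/
theorem exists_sparse_cell {m : ℕ} (hm : 0 < m) (d : Fin N → ℂ) :
    ∃ r₀ : ℕ, r₀ < m ∧ (Finset.univ.filter fun i : Fin N => cellOf m (d i) = r₀).card ≤ N / m + 1 := by
  classical
  have hne : (Finset.range m).Nonempty := Finset.nonempty_range_iff.2 hm.ne'
  have hcard : (Finset.univ : Finset (Fin N)).card ≤ (Finset.range m).card * (N / m + 1) := by
    rw [Finset.card_univ, Fintype.card_fin, Finset.card_range]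
    exact (Nat.lt_mul_div_succ N hm).le
  obtain ⟨y, hy, h⟩ := Finset.exists_card_fiber_le_of_card_le_mul (f := fun i : Fin N => cellOf m (d i)) hne hcard
  exact ⟨y, Finset.mem_range.1 hy, h⟩

/-- The angle of `d_i` measured from the cut `c₀`, in `[0, 2π)`. -/
def cutAngle (c₀ : ℝ) (z : ℂ) : ℝ := if c₀ ≤ angleOf z then angleOf z - c₀ else angleOf z - c₀ + 2 * π

/-- `0 ≤ cutAngle c₀ z` for `c₀ ≤ 2π`. -/
theorem cutAngle_nonneg {c₀ : ℝ} (hc : c₀ ≤ 2 * π) (z : ℂ) : 0 ≤ cutAngle c₀ z := by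
  unfold cutAngle
  split_ifs with h
  · linarith
  · linarith [angleOf_nonneg z]

/-- `cutAngle c₀ z < 2π` for `0 ≤ c₀`. -/
theorem cutAngle_lt {c₀ : ℝ} (hc : 0 ≤ c₀) (z : ℂ) : cutAngle c₀ z < 2 * π := by
  unfold cutAngle
  split_ifs with h
  · linarith [angleOf_lt_two_pi z]
  · push Not at h; linarith

/-- Differences of cut angles agree with differences of angles modulo `2π`: same cosine. -/
theorem cos_cutAngle_sub (c₀ : ℝ) (z z' : ℂ) :
    Real.cos (cutAngle c₀ z - cutAngle c₀ z') = Real.cos (angleOf z - angleOf z') := by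
  unfold cutAngle
  split_ifs with h h'
  · congr 1; ring
  · rw [show angleOf z - c₀ - (angleOf z' - c₀ + 2 * π) = (angleOf z - angleOf z') - 2 * π by ring, Real.cos_sub_two_pi]
  · rw [show angleOf z - c₀ + 2 * π - (angleOf z' - c₀) = (angleOf z - angleOf z') + 2 * π by ring, Real.cos_add_two_pi]
  · congr 1; ring

/-- For unit `z, z'`: `|z − z'|² = 2 − 2cos(cutAngle z − cutAngle z')`. -/
theorem norm_sub_sq_eq_cutAngle (c₀ : ℝ) {z z' : ℂ} (hz : ‖z‖ = 1) (hz' : ‖z'‖ = 1) :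
    ‖z - z'‖ ^ 2 = 2 - 2 * Real.cos (cutAngle c₀ z - cutAngle c₀ z') := by
  rw [cos_cutAngle_sub, norm_sub_sq_eq_angleOf hz hz']

/-- **Bad points lie in the sparse cell**: with `α = 2π/m`, `c₀ = (r₀+1)α`, `r₀ < m`: `cutAngle c₀ z > 2π − α ⇒ cellOf m z = r₀`. -/
theorem cellOf_eq_of_cutAngle_gt {m r₀ : ℕ} (hm : 0 < m) (z : ℂ)
    (hz : 2 * π - 2 * π / m < cutAngle ((r₀ + 1) * (2 * π / m)) z) : cellOf m z = r₀ := by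
  have hw : 0 < 2 * π / m := by positivity
  have hmw : (m : ℝ) * (2 * π / m) = 2 * π := by field_simp
  have hlt := angleOf_lt_two_pi z
  have h0 := angleOf_nonneg z
  unfold cutAngle at hz
  split_ifs at hz with hc
  · -- `angleOf z ≥ c₀` and `angleOf z − c₀ > 2π − α` contradicts `angleOf z < 2π` since `c₀ ≥ α`
    exfalso
    have : (1 : ℝ) * (2 * π / m) ≤ (r₀ + 1) * (2 * π / m) :=
      mul_le_mul_of_nonneg_right (by norm_cast; omega) hw.le
    linarith
  · push Not at hc
    -- `r₀ α < angleOf z < (r₀+1) α`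
    have hlow : (r₀ : ℝ) * (2 * π / m) < angleOf z := by nlinarith
    unfold cellOf
    rw [Nat.floor_eq_iff (div_nonneg h0 hw.le)]
    constructor
    · rw [le_div_iff₀ hw]; exact hlow.le
    · rw [div_lt_iff₀ hw]; exact hc

/-! ### C. The comparison of one factor -/

/-- **Unimodality**: for gaps `0 ≤ g ≤ g' ≤ 2π − α` (`0 ≤ α`, `g'` the larger gap): `cos g' ≤ max (cos g) (cos α)`. -/
theorem cos_le_max_of_gaps {α g g' : ℝ} (hα : 0 ≤ α) (hg : 0 ≤ g) (hgg' : g ≤ g') (hg' : g' ≤ 2 * π - α) :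
    Real.cos g' ≤ max (Real.cos g) (Real.cos α) := by
  by_cases h : α ≤ g
  · exact (cos_le_cos_of_mem_Icc hα (h.trans hgg') hg').trans (le_max_right _ _)
  · push Not at h
    exact (cos_le_cos_of_mem_Icc hg hgg' (by linarith)).trans (le_max_left _ _)

/-- **Good-row factor**: if `a ≥ min x c` with `0 ≤ x ≤ 4`, `0 < c`, `0 < t ≤ 1`, `κ = max 2 (8/c)`, then
`(1 + a/(2t))⁻¹ ≤ pairFactor (κt) x`. -/
theorem inv_one_add_le_pairFactor {a x c t κ : ℝ} (ht : 0 < t) (hc : 0 < c) (hx0 : 0 ≤ x) (hx4 : x ≤ 4)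
    (ha : min x c ≤ a) (hκ : max 2 (8 / c) ≤ κ) :
    (1 + a / (2 * t))⁻¹ ≤ pairFactor (κ * t) x := by
  have hκ2 : 2 ≤ κ := (le_max_left _ _).trans hκ
  have hκc : 8 / c ≤ κ := (le_max_right _ _).trans hκ
  have hκt : 0 < κ * t := mul_pos (by linarith) ht
  have hmin0 : 0 ≤ min x c := le_min hx0 hc.le
  have ha0 : 0 ≤ a := hmin0.trans ha
  -- `(1 + a/(2t))⁻¹ = 2t/(2t + a) ≤ 2t/(2t + min x c)`
  have h1 : (1 + a / (2 * t))⁻¹ ≤ 2 * t / (2 * t + min x c) := by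
    rw [show (1 + a / (2 * t))⁻¹ = 2 * t / (2 * t + a) by field_simp]
    exact div_le_div_of_nonneg_left (by linarith) (by linarith) (by linarith)
  refine h1.trans ?_
  unfold pairFactor
  split_ifs with hle
  · -- `≤ 1`
    rw [div_le_one (by linarith)]; linarith
  · push Not at hle
    -- target `κ t / x`, with `x > κ t`
    have hxpos : 0 < x := hκt.trans hle
    rcases le_total x c with hxc | hcx
    · rw [min_eq_left hxc]
      -- `2t/(2t+x) ≤ 2t/x ≤ κt/x`
      calc 2 * t / (2 * t + x) ≤ 2 * t / x := div_le_div_of_nonneg_left (by linarith) hxpos (by linarith)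
        _ ≤ κ * t / x := by gcongr
    · rw [min_eq_right hcx]
      -- `2t/(2t+c) ≤ 2t/c ≤ κ t/4 ≤ κ t / x`
      calc 2 * t / (2 * t + c) ≤ 2 * t / c := div_le_div_of_nonneg_left (by linarith) hc (by linarith)
        _ = (8 / c) * t / 4 := by ring
        _ ≤ κ * t / 4 := by gcongr
        _ ≤ κ * t / x := div_le_div_of_nonneg_left hκt.le hxpos hx4

/-- **Bad-row factor**: for `0 < t ≤ 1`, `κ ≥ 2`, `x ≤ 4`: `(1 + a/(2t))⁻¹ ≤ pairFactor (κt) x · (2/t)` (`a ≥ 0`). -/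
theorem inv_one_add_le_pairFactor_mul {a x t κ : ℝ} (ht : 0 < t) (ht1 : t ≤ 1) (hx4 : x ≤ 4) (ha : 0 ≤ a) (hκ : 2 ≤ κ) :
    (1 + a / (2 * t))⁻¹ ≤ pairFactor (κ * t) x * (2 / t) := by
  have h1 : (1 + a / (2 * t))⁻¹ ≤ 1 := inv_le_one_of_one_le₀ (by have := div_nonneg ha (by linarith : (0:ℝ) ≤ 2 * t); linarith)
  refine h1.trans ?_
  unfold pairFactor
  split_ifs with hle
  · rw [one_mul, le_div_iff₀ ht]; linarith
  · push Not at hle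
    have hxpos : 0 < x := (mul_pos (by linarith) ht).trans hle
    rw [div_mul_div_comm, le_div_iff₀ (mul_pos hxpos ht)]
    nlinarith

/-- `∏_k ∏_{j>k} b_j ≤ ∏_j b_j^N` for `b ≥ 1`. -/
theorem prod_Ioi_le_prod_pow (b : Fin N → ℝ) (hb : ∀ j, 1 ≤ b j) :
    ∏ k : Fin N, ∏ j ∈ Finset.Ioi k, b j ≤ ∏ j : Fin N, b j ^ N := by
  have hcomm : ∏ k : Fin N, ∏ j ∈ Finset.Ioi k, b j = ∏ j : Fin N, ∏ _k ∈ Finset.Iio j, b j :=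
    Finset.prod_comm' fun k j => by simp [Finset.mem_Ioi, Finset.mem_Iio]
  rw [hcomm]
  refine Finset.prod_le_prod (fun j _ => Finset.prod_nonneg fun _ _ => zero_le_one.trans (hb j)) fun j _ => ?_
  rw [Finset.prod_const]
  exact pow_le_pow_right₀ (hb j) ((Finset.card_le_univ _).trans (by simp))

/-- The count of indices satisfying a predicate is invariant under relabelling by a permutation. -/
theorem card_filter_comp_perm (σ : Equiv.Perm (Fin N)) (p : Fin N → Prop) [DecidablePred p] :
    (Finset.univ.filter fun j => p (σ j)).card = (Finset.univ.filter p).card := by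
  rw [← Finset.card_map σ.toEmbedding]
  congr 1
  ext i
  simp only [Finset.mem_map_equiv, Finset.mem_filter, Finset.mem_univ, true_and]
  rw [Equiv.apply_symm_apply]

/-- **Bookkeeping of the bad rows**: `(2/t)^{N(N/m+1)} ≤ exp(N²(log 4 − η log t))` for `m ≤ N`, `2/η ≤ m`, `0 < t ≤ 1`. -/
theorem bad_rows_bookkeeping {η t : ℝ} {m N : ℕ} (hη : 0 < η) (hmη : 2 / η ≤ m) (hm : 0 < m) (hmN : m ≤ N)
    (ht : 0 < t) (ht1 : t ≤ 1) :
    (2 / t) ^ (N * (N / m + 1)) ≤ Real.exp ((N : ℝ) ^ 2 * (Real.log 4 - η * Real.log t)) := by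
  have h2t : 1 ≤ 2 / t := by rw [le_div_iff₀ ht]; linarith
  have hlogt : Real.log t ≤ 0 := Real.log_nonpos ht.le ht1
  have hmr : (0 : ℝ) < m := by exact_mod_cast hm
  have hNm : (m : ℝ) ≤ N := by exact_mod_cast hmN
  -- exponent as a real: `N (N/m + 1) ≤ 2 N²/m`
  have hexp : ((N * (N / m + 1) : ℕ) : ℝ) ≤ 2 * (N : ℝ) ^ 2 / m := by
    have hdiv : ((N / m : ℕ) : ℝ) ≤ (N : ℝ) / m := Nat.cast_div_le
    have h1 : (1 : ℝ) ≤ (N : ℝ) / m := by rw [le_div_iff₀ hmr]; linarith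
    push_cast
    have hN0 : (0 : ℝ) ≤ N := Nat.cast_nonneg N
    calc (N : ℝ) * ((N / m : ℕ) + 1) ≤ N * ((N : ℝ) / m + (N : ℝ) / m) := by gcongr
      _ = 2 * (N : ℝ) ^ 2 / m := by ring
  rw [← Real.rpow_natCast, Real.rpow_def_of_pos (by positivity)]
  refine Real.exp_le_exp.2 ?_
  have hlog2t : 0 ≤ Real.log (2 / t) := Real.log_nonneg h2t
  have hlog : Real.log (2 / t) = Real.log 2 - Real.log t := by rw [Real.log_div (by norm_num) ht.ne']
  have hlog2 : 0 ≤ Real.log 2 := Real.log_nonneg (by norm_num)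
  have h2m : 2 / (m : ℝ) ≤ η := by
    rw [div_le_iff₀ hmr]; rw [div_le_iff₀ hη] at hmη; linarith
  have h2m1 : 2 / (m : ℝ) * Real.log 2 ≤ Real.log 4 := by
    -- `2/m · log 2 ≤ 2 log 2 = log 4` since `m ≥ 1`
    have h1m : (1 : ℝ) ≤ m := by exact_mod_cast hm
    have : 2 / (m : ℝ) ≤ 2 := by rw [div_le_iff₀ hmr]; linarith
    calc 2 / (m : ℝ) * Real.log 2 ≤ 2 * Real.log 2 := mul_le_mul_of_nonneg_right this hlog2
      _ = Real.log 4 := by rw [← Real.log_rpow (by norm_num)]; norm_num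
  have hN0 : (0 : ℝ) ≤ (N : ℝ) ^ 2 := by positivity
  calc Real.log (2 / t) * ((N * (N / m + 1) : ℕ) : ℝ)
      ≤ Real.log (2 / t) * (2 * (N : ℝ) ^ 2 / m) := mul_le_mul_of_nonneg_left hexp hlog2t
    _ = (N : ℝ) ^ 2 * ((2 / m) * Real.log 2 + (2 / m) * (-Real.log t)) := by rw [hlog]; ring
    _ ≤ (N : ℝ) ^ 2 * (Real.log 4 + η * (-Real.log t)) := by
        refine mul_le_mul_of_nonneg_left (add_le_add h2m1 ?_) hN0
        exact mul_le_mul_of_nonneg_right h2m (by linarith)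
    _ = (N : ℝ) ^ 2 * (Real.log 4 - η * Real.log t) := by ring

end Summit.QuantumFields.YangMills.Theorems.EguchiKawaiDirectionLadder

end
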